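import Summits.ValiantsHypothesis.ValiantsHypothesis.Theorems.SymPencilPerFourCrossPairNoJoint

/-!
# Route `SymPencil` — no JOINT family of four squares on a subspace containing
# `E₀₂ − E₁₀ + E₁₁` and `E₀₀ + E₁₂` (the skew two-row plane; `--supports` stmt-ValiantsHypothesis-5674
# `SdcSuperquadratic`)

Third V-side brick for the size-`27` cell `(11, 5, 4)` (after `SymPencilPerFourCrossPairNoJoint`,
`SymPencilPerFourRowPairNoJoint`).  The two-row spaces
`V(L) = {row 0 ∈ e₃^⊥, row 1 ∈ L}` (`L ⊆ K^{012}` a `2`-plane) are `5`-dimensional, singular, and carry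
per-base-point and per-direction families of four squares for EVERY `L` (the `2 × 2`
subpermanents `P_{j3}` vanish, so `rank Hess per_4 ≤ 4`); up to the torus there are three planes
`L`: the coordinate plane (`V₅⁼`, killed by `…RowPairNoJoint`), the skew plane
`L₂ = span {e₀ − e₁, e₂}` (this file) and `L₃ = (1,1,1)^⊥` (`…RowPairSumNoJoint`).

**Theorem** (`not_jointFamily_four_of_row_pair_skew`).  Let `V` be ANY subspace of `K^{4×4}`
(characteristic `0`) containing `y⁰ = E₀₂ − E₁₀ + E₁₁` and `y¹ = E₀₀ + E₁₂`.  Then `V` carries no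
joint bilinear family of four squares (`c : Fin 4 → K`, `β_k` bilinear,
`per_4 (u + s y) = e₀ + s e₁ + s² Σ_k c_k β_k(u, y)²` for all `u`, `y ∈ V`).

Proof: along `y(t) = y⁰ + t y¹` (rows `(t, 0, 1, 0)`, `(−1, 1, t, 0)`) the subpermanents are
`P₁₂ = 1`, `P₀₂ = t² − 1`, `P₀₁ = t`, the `s²`-coefficient is
`Q_t(u) = u₃₃ (u₂₀ + (t²−1) u₂₁ + t u₂₂) + u₂₃ (u₃₀ + (t²−1) u₃₁ + t u₃₂)`, the Gram matrix on
`U = (e₃₃, e₂₀, e₂₃, e₃₀)` is `½ J`, the radical vector is `z(t) = (t²−1) e₂₀ − e₂₁`, and the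
`t², t³` coefficients of `c_k β_k(z(t), y(t)) = 0` give `c_k β_k(e₂₀, y⁰) = c_k β_k(e₂₀, y¹) = 0`,
contradicting `Σ_k c_k β_k(e₂₀, y(1)) β_k(e₃₃, y(1)) = ½`.

Honest framing: a brick towards «no `5`-dimensional singular `V` carries a joint family of four
squares» (crux workfile `Cruxes/SdcSuperquadratic/TORIC-SIX.md` §X); `27 ≤ sdc(per₄) ≤ 29` unchanged,
the crux `SdcSuperquadratic` and `VP ≠ VNP` untouched.  No definitions, no named facts. [folklore]
-/

noncomputable section

-- single-conjunct layout: Sub = Summit, duplicated namespace component intended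
set_option linter.dupNamespace false

namespace Summit.ValiantsHypothesis.ValiantsHypothesis.Theorems.SymPencilPerFourRowPairSkewNoJoint

open MvPolynomial Module Matrix
open Literature.Computability.AlgebraicComplexity
open Summit.ValiantsHypothesis.ValiantsHypothesis.Theorems.SymPencilBoxFourEquality
open Summit.ValiantsHypothesis.ValiantsHypothesis.Theorems.SymPencilPerFourCrossPairNoJoint

variable {K : Type*} [Field K]

/-- **No joint family of four squares on a subspace containing `E₀₂ − E₁₀ + E₁₁` and `E₀₀ + E₁₂`.**
See the module docstring. [folklore] -/
theorem not_jointFamily_four_of_row_pair_skew [CharZero K] (V : Submodule K (Fin 4 × Fin 4 → K))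
    (h₀ : (fun p : Fin 4 × Fin 4 =>
      if p = (0, 2) then (1 : K) else if p = (1, 0) then -1 else if p = (1, 1) then 1 else 0) ∈ V)
    (h₁ : (fun p : Fin 4 × Fin 4 => if p = (0, 0) then (1 : K) else if p = (1, 2) then 1 else 0) ∈ V)
    (c : Fin 4 → K) (β : Fin 4 → ((Fin 4 × Fin 4 → K) →ₗ[K] (Fin 4 × Fin 4 → K) →ₗ[K] K)) :
    ¬ (∀ u : Fin 4 × Fin 4 → K, ∀ y ∈ V, ∃ e₀ e₁ : K, ∀ s : K,
        eval (u + s • y) (perPoly (Fin 4) K) = e₀ + s * e₁ + s ^ 2 * ∑ k, c k * (β k u y) ^ 2) := by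
  classical
  intro hj
  have hcases : ∀ i : Fin 4, i = 0 ∨ i = 1 ∨ i = 2 ∨ i = 3 := by decide
  -- the two generators and the line `y(t) = y₀ + t y₁`
  set y₀ : Fin 4 × Fin 4 → K :=
    fun p => if p = (0, 2) then (1 : K) else if p = (1, 0) then -1 else if p = (1, 1) then 1 else 0
    with hy₀
  set y₁ : Fin 4 × Fin 4 → K :=
    fun p => if p = (0, 0) then (1 : K) else if p = (1, 2) then 1 else 0 with hy₁
  have hyV : ∀ t : K, y₀ + t • y₁ ∈ V := fun t => V.add_mem h₀ (V.smul_mem t h₁)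
  -- Fin 4 literal facts
  obtain ⟨f01, f02, f03, f10, f12, f13, f20, f21, f23, f30, f31, f32⟩ :
      (((0 : Fin 4) = 1) = False) ∧ (((0 : Fin 4) = 2) = False) ∧ (((0 : Fin 4) = 3) = False) ∧
      (((1 : Fin 4) = 0) = False) ∧ (((1 : Fin 4) = 2) = False) ∧ (((1 : Fin 4) = 3) = False) ∧
      (((2 : Fin 4) = 0) = False) ∧ (((2 : Fin 4) = 1) = False) ∧ (((2 : Fin 4) = 3) = False) ∧
      (((3 : Fin 4) = 0) = False) ∧ (((3 : Fin 4) = 1) = False) ∧ (((3 : Fin 4) = 2) = False) := by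
    refine ⟨?_, ?_, ?_, ?_, ?_, ?_, ?_, ?_, ?_, ?_, ?_, ?_⟩ <;> decide
  -- `succAbove` on `Fin 4` (rows / columns `0, 1, 2` only are needed)
  obtain ⟨e00, e01, e02, e10, e11, e12, e20, e21, e22⟩ :
      (0 : Fin 4).succAbove 0 = 1 ∧ (0 : Fin 4).succAbove 1 = 2 ∧ (0 : Fin 4).succAbove 2 = 3 ∧
      (1 : Fin 4).succAbove 0 = 0 ∧ (1 : Fin 4).succAbove 1 = 2 ∧ (1 : Fin 4).succAbove 2 = 3 ∧
      (2 : Fin 4).succAbove 0 = 0 ∧ (2 : Fin 4).succAbove 1 = 1 ∧ (2 : Fin 4).succAbove 2 = 3 := by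
    decide
  -- (A) the `s²`-coefficient `Q t u` along the line (an opaque name with its defining equation)
  obtain ⟨Q, hQ⟩ : ∃ Q : K → (Fin 4 × Fin 4 → K) → K, ∀ t u, Q t u =
      u (3, 3) * (u (2, 0) + (t ^ 2 - 1) * u (2, 1) + t * u (2, 2)) +
        u (2, 3) * (u (3, 0) + (t ^ 2 - 1) * u (3, 1) + t * u (3, 2)) := ⟨_, fun _ _ => rfl⟩
  have hA : ∀ (t : K) (u : Fin 4 × Fin 4 → K) (s : K),
      eval (u + s • (y₀ + t • y₁)) (perPoly (Fin 4) K) =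
        (Matrix.of fun i j => u (i, j)).permanent +
        s * (((Matrix.of fun i j => u (i, j)).submatrix (0 : Fin 4).succAbove
              (2 : Fin 4).succAbove).permanent -
            ((Matrix.of fun i j => u (i, j)).submatrix (1 : Fin 4).succAbove
              (0 : Fin 4).succAbove).permanent +
            ((Matrix.of fun i j => u (i, j)).submatrix (1 : Fin 4).succAbove
              (1 : Fin 4).succAbove).permanent +
            t * ((Matrix.of fun i j => u (i, j)).submatrix (0 : Fin 4).succAbove
              (0 : Fin 4).succAbove).permanent +
            t * ((Matrix.of fun i j => u (i, j)).submatrix (1 : Fin 4).succAbove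
              (2 : Fin 4).succAbove).permanent) +
        s ^ 2 * Q t u := by
    intro t u s
    rw [eval_perPoly, Matrix.permanent_fin_four_row, Matrix.permanent_fin_four_row, hQ]
    simp only [Matrix.permanent_fin_three_row, Matrix.of_apply, Matrix.submatrix_apply, Pi.add_apply,
      Pi.smul_apply, smul_eq_mul, hy₀, hy₁, Prod.mk.injEq, e00, e01, e02, e10, e11, e12, e20, e21,
      e22, f01, f02, f10, f12, f20, f21, f30, f31, f32, and_true, and_false, if_true, if_false]
    ring
  -- (B) coefficient extraction
  have hB : ∀ (t : K) (u : Fin 4 × Fin 4 → K),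
      c 0 * (β 0 u (y₀ + t • y₁)) ^ 2 + c 1 * (β 1 u (y₀ + t • y₁)) ^ 2 +
        c 2 * (β 2 u (y₀ + t • y₁)) ^ 2 + c 3 * (β 3 u (y₀ + t • y₁)) ^ 2 = Q t u := by
    intro t u
    obtain ⟨e₀, e₁, he⟩ := hj u _ (hyV t)
    have h := coeff_two_eq_of_forall₂ (fun s => (he s).symm.trans (hA t u s))
    simpa only [Fin.sum_univ_four] using h
  -- (C) polarisation
  have hC : ∀ (t : K) (u u' : Fin 4 × Fin 4 → K),
      c 0 * β 0 u (y₀ + t • y₁) * β 0 u' (y₀ + t • y₁) +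
        c 1 * β 1 u (y₀ + t • y₁) * β 1 u' (y₀ + t • y₁) +
        c 2 * β 2 u (y₀ + t • y₁) * β 2 u' (y₀ + t • y₁) +
        c 3 * β 3 u (y₀ + t • y₁) * β 3 u' (y₀ + t • y₁) =
      2⁻¹ * (Q t (u + u') - Q t u - Q t u') := by
    intro t u u'
    have h := hB t (u + u')
    rw [map_add (β 0), map_add (β 1), map_add (β 2), map_add (β 3)] at h
    simp only [LinearMap.add_apply] at h
    have hu := hB t u
    have hu' := hB t u'
    linear_combination (2⁻¹ : K) * (h - hu - hu')
  -- the unit vectors, the four test vectors `U = (e₃₃, e₂₀, e₂₃, e₃₀)` and the Gram matrix `J`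
  obtain ⟨E, hE⟩ : ∃ E : Fin 4 × Fin 4 → (Fin 4 × Fin 4 → K), ∀ P p, E P p = if p = P then 1 else 0 :=
    ⟨fun P p => if p = P then 1 else 0, fun _ _ => rfl⟩
  obtain ⟨U, hU0, hU1, hU2, hU3⟩ : ∃ U : Fin 4 → (Fin 4 × Fin 4 → K),
      U 0 = E (3, 3) ∧ U 1 = E (2, 0) ∧ U 2 = E (2, 3) ∧ U 3 = E (3, 0) :=
    ⟨![E (3, 3), E (2, 0), E (2, 3), E (3, 0)], rfl, rfl, rfl, rfl⟩
  obtain ⟨J, hJ⟩ : ∃ J : Matrix (Fin 4) (Fin 4) K, ∀ i j, J i j =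
      if (i = 0 ∧ j = 1) ∨ (i = 1 ∧ j = 0) ∨ (i = 2 ∧ j = 3) ∨ (i = 3 ∧ j = 2) then 1 else 0 :=
    ⟨Matrix.of fun i j =>
      if (i = 0 ∧ j = 1) ∨ (i = 1 ∧ j = 0) ∨ (i = 2 ∧ j = 3) ∨ (i = 3 ∧ j = 2) then 1 else 0,
      fun _ _ => rfl⟩
  have hJJ : J * J = 1 := by
    ext i j
    rw [Matrix.mul_apply, Fin.sum_univ_four, Matrix.one_apply]
    rcases hcases i with rfl | rfl | rfl | rfl <;> rcases hcases j with rfl | rfl | rfl | rfl <;>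
      · simp only [hJ, f01, f02, f03, f10, f12, f13, f20, f21, f23, f30, f31, f32,
          and_true, and_false, or_true, or_false, if_true, if_false]
        ring
  -- Gram values on the test vectors: `½ (Q(Uᵢ+Uⱼ) - Q Uᵢ - Q Uⱼ) = ½ Jᵢⱼ`
  have hQU : ∀ (t : K) (i j : Fin 4),
      2⁻¹ * (Q t (U i + U j) - Q t (U i) - Q t (U j)) = 2⁻¹ * J i j := by
    intro t i j
    rcases hcases i with rfl | rfl | rfl | rfl <;> rcases hcases j with rfl | rfl | rfl | rfl <;>
      · simp only [hU0, hU1, hU2, hU3, hJ, hQ, hE, Pi.add_apply, Prod.mk.injEq, f01, f02, f03, f10,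
          f12, f13, f20, f21, f23, f30, f31, f32, and_true, and_false, or_true, or_false, if_true,
          if_false]
        ring
  -- the isotropic vector `z(t) = (t² - 1) e₂₀ - e₂₁` is `Q_t`-orthogonal to the test vectors
  have hQz : ∀ (t : K) (i : Fin 4),
      2⁻¹ * (Q t (U i + ((t ^ 2 - 1) • E (2, 0) - E (2, 1))) - Q t (U i) -
        Q t ((t ^ 2 - 1) • E (2, 0) - E (2, 1))) = 0 := by
    intro t i
    rcases hcases i with rfl | rfl | rfl | rfl <;>
      · simp only [hU0, hU1, hU2, hU3, hQ, hE, Pi.add_apply, Pi.sub_apply, Pi.smul_apply,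
          smul_eq_mul, Prod.mk.injEq, f01, f03, f10, f13, f20, f21, f23, f30, f31, f32, and_true,
          and_false, if_true, if_false]
        ring
  -- (D) the matrix step at parameter `t`: `B D Bᵀ = ½ J`, so `B` is invertible and
  -- `c_k β_k(z(t), y(t)) = 0`
  have hD : ∀ (t : K) (k : Fin 4),
      c k * β k ((t ^ 2 - 1) • E (2, 0) - E (2, 1)) (y₀ + t • y₁) = 0 := by
    intro t
    obtain ⟨B, hBdef⟩ : ∃ B : Matrix (Fin 4) (Fin 4) K, ∀ i k, B i k = β k (U i) (y₀ + t • y₁) :=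
      ⟨Matrix.of fun i k => β k (U i) (y₀ + t • y₁), fun _ _ => rfl⟩
    have hGram : B * Matrix.diagonal c * Bᵀ = (2⁻¹ : K) • J := by
      ext i j
      have hent : (B * Matrix.diagonal c * Bᵀ) i j =
          c 0 * β 0 (U i) (y₀ + t • y₁) * β 0 (U j) (y₀ + t • y₁) +
            c 1 * β 1 (U i) (y₀ + t • y₁) * β 1 (U j) (y₀ + t • y₁) +
            c 2 * β 2 (U i) (y₀ + t • y₁) * β 2 (U j) (y₀ + t • y₁) +
            c 3 * β 3 (U i) (y₀ + t • y₁) * β 3 (U j) (y₀ + t • y₁) := by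
        rw [Matrix.mul_apply, Fin.sum_univ_four]
        simp only [Matrix.mul_diagonal, Matrix.transpose_apply, hBdef]
        ring
      rw [hent, hC t (U i) (U j), Matrix.smul_apply, smul_eq_mul, hQU t i j]
    have hBR : B * ((2 : K) • (Matrix.diagonal c * Bᵀ * J)) = 1 := by
      rw [Matrix.mul_smul, ← Matrix.mul_assoc, ← Matrix.mul_assoc, hGram, Matrix.smul_mul,
        smul_smul, mul_inv_cancel₀ (two_ne_zero : (2 : K) ≠ 0), one_smul, hJJ]
    have hRB : ((2 : K) • (Matrix.diagonal c * Bᵀ * J)) * B = 1 := mul_eq_one_comm.1 hBR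
    -- the vector `v_k = c_k β_k(z, y)` is killed by `B`
    obtain ⟨v, hv⟩ : ∃ v : Fin 4 → K,
        ∀ k, v k = c k * β k ((t ^ 2 - 1) • E (2, 0) - E (2, 1)) (y₀ + t • y₁) := ⟨_, fun _ => rfl⟩
    have hBv : B.mulVec v = 0 := by
      funext i
      have hent : B.mulVec v i =
          c 0 * β 0 (U i) (y₀ + t • y₁) * β 0 ((t ^ 2 - 1) • E (2, 0) - E (2, 1)) (y₀ + t • y₁) +
            c 1 * β 1 (U i) (y₀ + t • y₁) * β 1 ((t ^ 2 - 1) • E (2, 0) - E (2, 1)) (y₀ + t • y₁) +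
            c 2 * β 2 (U i) (y₀ + t • y₁) * β 2 ((t ^ 2 - 1) • E (2, 0) - E (2, 1)) (y₀ + t • y₁) +
            c 3 * β 3 (U i) (y₀ + t • y₁) * β 3 ((t ^ 2 - 1) • E (2, 0) - E (2, 1)) (y₀ + t • y₁) := by
        simp only [Matrix.mulVec, dotProduct, hBdef, hv, Fin.sum_univ_four]
        ring
      rw [hent, hC t (U i) _, Pi.zero_apply, hQz t i]
    have hv0 : v = 0 := by
      have h : ((2 : K) • (Matrix.diagonal c * Bᵀ * J) * B).mulVec v = v := by
        rw [hRB, Matrix.one_mulVec]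
      rw [← Matrix.mulVec_mulVec, hBv, Matrix.mulVec_zero] at h
      exact h.symm
    intro k
    rw [← hv k, hv0, Pi.zero_apply]
  -- (E) the cubic in `t`: its `t²` and `t³` coefficients vanish
  have hE2 : ∀ k : Fin 4, c k * β k (E (2, 0)) y₀ = 0 ∧ c k * β k (E (2, 0)) y₁ = 0 := by
    intro k
    refine coeff_cubic_eq_zero (A := -(c k * β k (E (2, 0)) y₀ + c k * β k (E (2, 1)) y₀))
      (B := -(c k * β k (E (2, 0)) y₁ + c k * β k (E (2, 1)) y₁))
      fun t => ?_
    have h := hD t k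
    simp only [map_sub, map_smul, map_add, LinearMap.sub_apply, LinearMap.smul_apply,
      smul_eq_mul] at h
    linear_combination h
  -- (F) contradiction at `t = 1`
  have hF := hC 1 (E (2, 0)) (E (3, 3))
  have hJ10 : J 1 0 = 1 := by
    simp only [hJ, f10, f12, f13, f01, false_and, and_true, true_or, false_or, or_true,
      if_true]
  have hval := hQU 1 1 0
  rw [hU1, hU0, hJ10, mul_one] at hval
  have hsplit : ∀ k : Fin 4, c k * β k (E (2, 0)) (y₀ + (1 : K) • y₁) = 0 := fun k => by
    rw [one_smul, map_add, mul_add, (hE2 k).1, (hE2 k).2, add_zero]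
  have h2 : (2⁻¹ : K) = 0 := by
    rw [← hval, ← hF]
    linear_combination hsplit 0 * β 0 (E (3, 3)) (y₀ + (1 : K) • y₁) +
      hsplit 1 * β 1 (E (3, 3)) (y₀ + (1 : K) • y₁) +
      hsplit 2 * β 2 (E (3, 3)) (y₀ + (1 : K) • y₁) + hsplit 3 * β 3 (E (3, 3)) (y₀ + (1 : K) • y₁)
  exact (inv_ne_zero (two_ne_zero : (2 : K) ≠ 0)) h2

end Summit.ValiantsHypothesis.ValiantsHypothesis.Theorems.SymPencilPerFourRowPairSkewNoJoint

end
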